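import Summits.BirchSwinnertonDyer.BirchSwinnertonDyer.Theorems.GenusKolyvaginAtTwoMinimalTwinBSDTwoAnalyticTwinNoTwoTorsion
import Literature.NumberTheory.EllipticCurves.SelmerGroupCardinality
import HarnessLib

/-!
# Route `GenusKolyvaginAtTwo` — CENSUS OF THE RANK-ONE HALF OF THE LEAF after director-bsd (687)/(697): U₂ `MinimalTwinBSDTwo` and the residual
# R′ «non-CM, `r_an = 1`, `#Sel₂(W) ≠ 2` ⟹ BSD₂» (`RankOneNonMinimalResidualAtTwo`, item stmt-BirchSwinnertonDyer-27107, route rev 65), BY CELLS AND BY NAME (LEAD gk2-p1 g31)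

Seat `bsd-line-gk2-p1` g31 (LEAD lineage, cell `bsd-f1-sign2`).  THEOREMS ONLY, standard axioms, no `sorry`; conditional theorems display their
hypotheses.  **BSD is NOT proved by this file; U₂, R′, the WALL rows and KEX⁰ stay OPEN; nothing is closed.**

* §1 (any number field) rank one ⟹ (`#Sel₂ = 2` ⟺ `#E(F)[2] = 1 ∧ #(Ш ⊓ H¹[2]) = 1`) — the exact descent count `#Sel₂ = 2^{rank}·#E[2]·#Ш[2]`
  (Silverman X.4.2, tree `card_selmerGroup_eq_pow_rank_mul`); so at analytic rank one (GZK) the residual's hypothesis `#Sel₂(W) ≠ 2` reads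
  «`W(ℚ)[2] ≠ 0` (TORSION cell) or `Ш(W)[2] ≠ 0` (Ш cell)».
* §2 BY NAME: U₂ ⟸ WALL row 1 + Friedberg–Hoffstein + KEX⁰ + PRINT (KEX⁰ = LINE 23's index relation KEX′ with `#Sel₂(W) = 2` replaced by `W(ℚ)[2] = 0`,
  engine `…AnalyticTwin.NoTwoTorsion`), and KEX⁰ ⟹ KEX′.
* §3 the whole rank-one half, BY NAME (`MinimalTwinBSDTwo` 22985, `RankOneNonMinimalResidualAtTwo` 27107, rev 65): «BSD₂ for every non-CM `W`
  with `r_an = 1`» ⟺ U₂ ∧ R′ (logic); R′ ⟹ its torsion cell; and R′ ⟸ WALL row 1 + FH + KEX⁰ + PRINT + the TORSION cell alone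
  (`rankOneNonMinimalResidualAtTwo_of_kex0_of_torsionCell_of_facts`): modulo WALL + PRINT, **U₂ ∧ R′ ⟺ KEX⁰ ∧ R′_tors** — the Ш cell of the residual is in the
  same Kolyvagin currency as U₂; only the torsion cell (reducible `ρ̄_{W,2}`; no Heegner–Kolyvagin engine at `2`; print: Cai–Li–Zhai 2020 is rank `0`,
  Coates–Li–Tian–Zhai 2015's rank-one theorem is CM `X₀(49)`, Creutz–Miller is `N < 5000`) is outside every engine of the route.

References: [SilvermanAEC2009] Thm X.4.2; [Miller2011LMS] Def. 1.1; [GrossZagier1986] V.§2; [FriedbergHoffstein1995]; [Milne1972ArithmeticAV] §1 Thm. 1.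
-/

set_option autoImplicit false
set_option linter.dupNamespace false -- `Summit.<P>.<Sub>` repeats `BirchSwinnertonDyer` (D-0017)

noncomputable section

open scoped Classical

open WeierstrassCurve NumberField Literature.NumberTheory.EllipticCurves
  Literature.NumberTheory.EllipticCurves.ModularForms
  Summit.BirchSwinnertonDyer.BirchSwinnertonDyer.Theorems.GenusExact.TwinSwap
  Summit.BirchSwinnertonDyer.BirchSwinnertonDyer.Theorems.GenusExact.TwinSwap.AnalyticTwin.NoTwoTorsion
open Summit.BirchSwinnertonDyer.BirchSwinnertonDyer.Theses.GenusKolyvaginAtTwo (MinimalTwinBSDTwo RankOneNonMinimalResidualAtTwo)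

namespace Summit.BirchSwinnertonDyer.BirchSwinnertonDyer.Theorems.GenusExact.TwinSwap.AnalyticTwin.NoTwoTorsion.Census

/-! ## §1 Rank one: `#Sel₂ = 2` iff no `2`-torsion and no `Ш[2]` — the two cells of the residual -/

section AnyField

variable {F : Type} [Field F] [NumberField F]

/-- **Rank one: `#Sel₂(E/F) = 2 ⟺ E(F)[2] = 0 ∧ Ш(E/F)[2] = 0`** (as cardinalities `= 1`), from the exact descent count
`#Sel₂ = 2^{rank} · #E(F)[2] · #(Ш ⊓ H¹(F,E)[2])`. [cite: SilvermanAEC2009, Thm X.4.2] -/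
theorem natCard_selmerGroup_two_eq_two_iff_of_rank_one (X : WeierstrassCurve F) [X.IsElliptic]
    (h1 : X.mordellWeilRank = 1) :
    Nat.card (X.selmerGroup 2) = 2 ↔
      Nat.card (AddSubgroup.torsionBy X.toAffine.Point 2) = 1 ∧
        Nat.card (X.sha ⊓ AddSubgroup.torsionBy X.galH1 2 : AddSubgroup X.galH1) = 1 := by
  have hcount := card_selmerGroup_eq_pow_rank_mul X 2
  simp only [Nat.cast_ofNat] at hcount
  rw [h1, pow_one, mul_assoc] at hcount
  rw [hcount]
  constructor
  · intro h
    have hprod := Nat.eq_of_mul_eq_mul_left (show 0 < 2 by norm_num) (h.trans (mul_one 2).symm)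
    exact ⟨Nat.eq_one_of_mul_eq_one_right hprod, Nat.eq_one_of_mul_eq_one_left hprod⟩
  · rintro ⟨ha, hb⟩
    rw [ha, hb, mul_one, mul_one]

/-- **Rank one: `#Sel₂(E/F) ≠ 2 ⟺ E(F)[2] ≠ 0 ∨ Ш(E/F)[2] ≠ 0`** — TORSION cell or Ш cell. [cite: SilvermanAEC2009, Thm X.4.2] -/
theorem natCard_selmerGroup_two_ne_two_iff_of_rank_one (X : WeierstrassCurve F) [X.IsElliptic]
    (h1 : X.mordellWeilRank = 1) :
    Nat.card (X.selmerGroup 2) ≠ 2 ↔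
      Nat.card (AddSubgroup.torsionBy X.toAffine.Point 2) ≠ 1 ∨
        Nat.card (X.sha ⊓ AddSubgroup.torsionBy X.galH1 2 : AddSubgroup X.galH1) ≠ 1 := by
  rw [Ne, natCard_selmerGroup_two_eq_two_iff_of_rank_one X h1, not_and_or]

omit [NumberField F] in
/-- `E(F)[2] = 0` as points ⟺ `#E(F)[2] = 1`. [folklore] -/
theorem forall_two_smul_eq_zero_iff_natCard_torsionBy_eq_one (X : WeierstrassCurve F) [X.IsElliptic] :
    (∀ P : X.toAffine.Point, 2 • P = 0 → P = 0) ↔ Nat.card (AddSubgroup.torsionBy X.toAffine.Point 2) = 1 := by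
  constructor
  · intro h
    haveI : Subsingleton (AddSubgroup.torsionBy X.toAffine.Point 2) := ⟨fun a b ↦ by
      have ha : (a : X.toAffine.Point) = 0 := h a (AddSubgroup.torsionBy.nsmul_iff.mp a.2)
      have hb : (b : X.toAffine.Point) = 0 := h b (AddSubgroup.torsionBy.nsmul_iff.mp b.2)
      exact Subtype.ext (ha.trans hb.symm)⟩
    exact Nat.card_unique
  · intro h P hP
    have hsub : Subsingleton (AddSubgroup.torsionBy X.toAffine.Point 2) := (Nat.card_eq_one_iff_unique.mp h).1
    have hmem : P ∈ AddSubgroup.torsionBy X.toAffine.Point 2 := AddSubgroup.torsionBy.nsmul_iff.mpr hP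
    exact congrArg Subtype.val
      (Subsingleton.elim (⟨P, hmem⟩ : AddSubgroup.torsionBy X.toAffine.Point 2) ⟨0, AddSubgroup.zero_mem _⟩)

/-- **Rank one with a rational `2`-torsion point ⟹ `#Sel₂ ≠ 2`** (the torsion cell lies in the residual). [cite: SilvermanAEC2009, Thm X.4.2] -/
theorem natCard_selmerGroup_two_ne_two_of_twoTorsion (X : WeierstrassCurve F) [X.IsElliptic]
    (h1 : X.mordellWeilRank = 1) (hT : ¬ ∀ P : X.toAffine.Point, 2 • P = 0 → P = 0) :
    Nat.card (X.selmerGroup 2) ≠ 2 := by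
  rw [natCard_selmerGroup_two_ne_two_iff_of_rank_one X h1]
  exact Or.inl fun h ↦ hT ((forall_two_smul_eq_zero_iff_natCard_torsionBy_eq_one X).mpr h)

end AnyField

/-! ## §2 Over `ℚ` at analytic rank one: the cells, U₂ BY NAME from KEX⁰, KEX⁰ ⟹ KEX′ -/

/-- **The residual's hypothesis, read on curves**: for `W/ℚ` of analytic rank `1` (Mordell–Weil rank `1` by GZK = item `MultPublishedInputsAtTwo`),
`#Sel₂(W) ≠ 2 ⟺ W(ℚ)[2] ≠ 0 ∨ Ш(W)[2] ≠ 0`. [cite: SilvermanAEC2009, Thm X.4.2] -/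
theorem natCard_selmerGroup_two_ne_two_iff_of_analyticRank_one (hGZK : rank_eq_analyticRank_of_analyticRank_le_one)
    (W : WeierstrassCurve ℚ) [W.IsElliptic] (hr : W.analyticRank = 1) :
    Nat.card (W.selmerGroup 2) ≠ 2 ↔
      (¬ ∀ P : W.toAffine.Point, 2 • P = 0 → P = 0) ∨
        Nat.card (W.sha ⊓ AddSubgroup.torsionBy W.galH1 2 : AddSubgroup W.galH1) ≠ 1 := by
  have h1 : W.mordellWeilRank = 1 := ((hGZK W hr.le).1).trans hr
  have hgen := natCard_selmerGroup_two_ne_two_iff_of_rank_one W h1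
  simp only [ne_eq] at hgen ⊢
  rw [← forall_two_smul_eq_zero_iff_natCard_torsionBy_eq_one W] at hgen
  -- the group law on `W(ℚ)` is read under `instDecidableEqRat` here and under the classical instance in the generic lemma
  refine hgen.trans (or_congr (not_congr (forall_congr' fun P ↦ ?_)) Iff.rfl)
  constructor
  · intro h hP
    exact h (by convert hP)
  · intro h hP
    exact h (by convert hP)

/-- ★ **U₂ `MinimalTwinBSDTwo` BY NAME ⟸ WALL row 1 + Friedberg–Hoffstein + KEX⁰ + PRINT.**  (GZK turns `#Sel₂ = 2` into `W(ℚ)[2] = 0`; then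
`NoTwoTorsion.bsdp_of_wall_of_friedbergHoffstein_of_kex0_of_facts`.)  CONDITIONAL; proves nothing about BSD; closes nothing.
[cite: FriedbergHoffstein1995, main theorem] [cite: GrossZagier1986, V.§2 (2.2)] [cite: Milne1972ArithmeticAV, §1 Thm. 1] -/
theorem minimalTwinBSDTwo_of_wall_of_friedbergHoffstein_of_kex0_of_facts
    (hGZ : ∀ (N : ℕ) [NeZero N] (W : WeierstrassCurve ℚ) (K : Type) [Field K] [NumberField K], gross_zagier N W K)
    (hGZK : rank_eq_analyticRank_of_analyticRank_le_one) (hmod : hasEntireLFunction_rat)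
    (hMilneC : Milne1972.bsdQuotient_baseChange_quadratic_anyModel) (hMP : nonempty_modularParametrizationData)
    (hFH : friedbergHoffstein_exists_heegnerField_split_twist_ne_zero)
    (hS1 : ∀ (W : WeierstrassCurve ℚ) [W.IsElliptic] [W.IsGloballyMinimal], ¬ W.HasCM → W.analyticRank = 0 → BSDp W 2)
    (hKEX0 : ∀ (W : WeierstrassCurve ℚ) [W.IsElliptic] [W.IsGloballyMinimal] [NeZero (W.conductorNorm ℤ)],
      ¬ W.HasCM → W.analyticRank = 1 → (∀ P : W.toAffine.Point, 2 • P = 0 → P = 0) →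
      ∀ (K : Type) [Field K] [NumberField K], IsImaginaryQuadratic K →
        Odd (NumberField.discr K) → NumberField.discr K ≠ -3 → SatisfiesHeegnerHypothesis (W.conductorNorm ℤ) K →
        ((Ideal.span {(2 : ℤ)}).primesOver (𝓞 K)).ncard = 2 →
        ∀ (Wd : WeierstrassCurve ℚ) [Wd.IsElliptic] [Wd.IsGloballyMinimal],
          (∃ C : VariableChange ℚ, C • W.quadraticTwist (NumberField.discr K : ℚ) = Wd) →
        (W.quadraticTwist (NumberField.discr K : ℚ)).entireLFunction 1 ≠ 0 →
        ∀ (Dt : ModularParametrizationData W (W.conductorNorm ℤ)) (β : ℤ) (ι : K →+* ℂ) (d₁ : KolyvaginHeegnerData Dt β ι 1),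
          ∃ M₀ : ℕ,
            (∃ Q : (W.baseChange (ringClassField K ι 1)).toAffine.Point, ((2 ^ M₀ : ℕ) : ℤ) • Q = d₁.derivedPoint) ∧
            (¬ ∃ Q : (W.baseChange (ringClassField K ι 1)).toAffine.Point, ((2 ^ (M₀ + 1) : ℕ) : ℤ) • Q = d₁.derivedPoint) ∧
            Nat.card (AddCommGroup.primaryComponent (W.baseChange K).sha 2) *
                2 ^ (2 * (padicValInt 2 Dt.c + padicValNat 2 W.tamagawaProduct)) = 2 ^ (2 * M₀)) :
    MinimalTwinBSDTwo := by
  intro W _ _ hcm hr hSel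
  have hrk : 1 ≤ W.mordellWeilRank := by rw [(hGZK W (le_of_eq hr)).1, hr]
  obtain ⟨-, hT2, -⟩ := rank_eq_one_and_sha_primary_eq_zero_of_natCard_selmerGroup_eq_two W hSel hrk
  exact bsdp_of_wall_of_friedbergHoffstein_of_kex0_of_facts hGZ hGZK hmod hMilneC hMP hFH hS1 hKEX0 W hcm hr
    (fun P hP ↦ by convert hT2 P (by convert hP))

/-! ## §3 The whole rank-one half of the leaf: U₂ ∧ R′ ⟺ «rank-one BSD₂» ⟸ WALL + FH + KEX⁰ + PRINT + the TORSION cell -/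

/-- **«BSD₂ for every non-CM `W` of analytic rank one» ⟺ U₂ ∧ R′**, both BY NAME (`MinimalTwinBSDTwo` 22985, `RankOneNonMinimalResidualAtTwo`
27107 of rev 65).  Pure logic (`by_cases` on `#Sel₂(W) = 2`). [folklore] -/
theorem rankOneBSDTwo_iff_minimalTwin_and_residual :
    (∀ (W : WeierstrassCurve ℚ) [W.IsElliptic] [W.IsGloballyMinimal], ¬ W.HasCM → W.analyticRank = 1 → BSDp W 2) ↔
      MinimalTwinBSDTwo ∧ RankOneNonMinimalResidualAtTwo := by
  constructor
  · intro h
    exact ⟨fun W _ _ hcm hr _ ↦ h W hcm hr, fun W _ _ hcm hr _ ↦ h W hcm hr⟩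
  · rintro ⟨hU, hR⟩ W _ _ hcm hr
    by_cases hSel : Nat.card (W.selmerGroup 2) = 2
    · exact hU W hcm hr hSel
    · exact hR W hcm hr hSel

/-- **The TORSION cell is a sub-statement of R′** (BY NAME): a rank-one curve with a rational `2`-torsion point has `#Sel₂ ≠ 2` (§1 + GZK), so R′
covers it. [cite: SilvermanAEC2009, Thm X.4.2] -/
theorem torsionCell_of_rankOneNonMinimalResidualAtTwo (hGZK : rank_eq_analyticRank_of_analyticRank_le_one)
    (hR : RankOneNonMinimalResidualAtTwo) :
    ∀ (W : WeierstrassCurve ℚ) [W.IsElliptic] [W.IsGloballyMinimal],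
      ¬ W.HasCM → W.analyticRank = 1 → (¬ ∀ P : W.toAffine.Point, 2 • P = 0 → P = 0) → BSDp W 2 := by
  intro W _ _ hcm hr hT
  have h1 : W.mordellWeilRank = 1 := ((hGZK W hr.le).1).trans hr
  exact hR W hcm hr (natCard_selmerGroup_two_ne_two_of_twoTorsion W h1 fun h ↦ hT fun P hP ↦ h P (by convert hP))

/-- ★ **THE RANK-ONE HALF OF THE LEAF ⟸ WALL row 1 + Friedberg–Hoffstein + KEX⁰ + PRINT + the TORSION cell ONLY.**  The torsion cell
R′_tors := «non-CM, `r_an = 1`, `W(ℚ)[2] ≠ 0` ⟹ BSD₂» is the one binder outside the Kolyvagin currency; everything else in U₂ ∧ R′ is KEX⁰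
(`NoTwoTorsion.bsdp_of_wall_of_friedbergHoffstein_of_kex0_of_facts`).  So modulo WALL + PRINT: **U₂ ∧ R′ ⟺ KEX⁰ ∧ R′_tors** (⟹ by this theorem and
`rankOneBSDTwo_iff_minimalTwin_and_residual`; ⟸ by `NoTwoTorsion.kex0_of_rankOneNoTwoTorsionBSDTwo_of_wall_of_facts`).  CONDITIONAL; proves nothing about
BSD; closes nothing.  [cite: FriedbergHoffstein1995, main theorem] [cite: GrossZagier1986, V.§2 (2.2)] [cite: Milne1972ArithmeticAV, §1 Thm. 1] -/
theorem rankOneBSDTwo_of_kex0_of_torsionCell_of_facts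
    (hGZ : ∀ (N : ℕ) [NeZero N] (W : WeierstrassCurve ℚ) (K : Type) [Field K] [NumberField K], gross_zagier N W K)
    (hGZK : rank_eq_analyticRank_of_analyticRank_le_one) (hmod : hasEntireLFunction_rat)
    (hMilneC : Milne1972.bsdQuotient_baseChange_quadratic_anyModel) (hMP : nonempty_modularParametrizationData)
    (hFH : friedbergHoffstein_exists_heegnerField_split_twist_ne_zero)
    (hS1 : ∀ (W : WeierstrassCurve ℚ) [W.IsElliptic] [W.IsGloballyMinimal], ¬ W.HasCM → W.analyticRank = 0 → BSDp W 2)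
    (hKEX0 : ∀ (W : WeierstrassCurve ℚ) [W.IsElliptic] [W.IsGloballyMinimal] [NeZero (W.conductorNorm ℤ)],
      ¬ W.HasCM → W.analyticRank = 1 → (∀ P : W.toAffine.Point, 2 • P = 0 → P = 0) →
      ∀ (K : Type) [Field K] [NumberField K], IsImaginaryQuadratic K →
        Odd (NumberField.discr K) → NumberField.discr K ≠ -3 → SatisfiesHeegnerHypothesis (W.conductorNorm ℤ) K →
        ((Ideal.span {(2 : ℤ)}).primesOver (𝓞 K)).ncard = 2 →
        ∀ (Wd : WeierstrassCurve ℚ) [Wd.IsElliptic] [Wd.IsGloballyMinimal],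
          (∃ C : VariableChange ℚ, C • W.quadraticTwist (NumberField.discr K : ℚ) = Wd) →
        (W.quadraticTwist (NumberField.discr K : ℚ)).entireLFunction 1 ≠ 0 →
        ∀ (Dt : ModularParametrizationData W (W.conductorNorm ℤ)) (β : ℤ) (ι : K →+* ℂ) (d₁ : KolyvaginHeegnerData Dt β ι 1),
          ∃ M₀ : ℕ,
            (∃ Q : (W.baseChange (ringClassField K ι 1)).toAffine.Point, ((2 ^ M₀ : ℕ) : ℤ) • Q = d₁.derivedPoint) ∧
            (¬ ∃ Q : (W.baseChange (ringClassField K ι 1)).toAffine.Point, ((2 ^ (M₀ + 1) : ℕ) : ℤ) • Q = d₁.derivedPoint) ∧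
            Nat.card (AddCommGroup.primaryComponent (W.baseChange K).sha 2) *
                2 ^ (2 * (padicValInt 2 Dt.c + padicValNat 2 W.tamagawaProduct)) = 2 ^ (2 * M₀))
    (hTors : ∀ (W : WeierstrassCurve ℚ) [W.IsElliptic] [W.IsGloballyMinimal],
      ¬ W.HasCM → W.analyticRank = 1 → (¬ ∀ P : W.toAffine.Point, 2 • P = 0 → P = 0) → BSDp W 2) :
    ∀ (W : WeierstrassCurve ℚ) [W.IsElliptic] [W.IsGloballyMinimal], ¬ W.HasCM → W.analyticRank = 1 → BSDp W 2 := by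
  intro W _ _ hcm hr
  by_cases hT : ∀ P : W.toAffine.Point, 2 • P = 0 → P = 0
  · exact bsdp_of_wall_of_friedbergHoffstein_of_kex0_of_facts hGZ hGZK hmod hMilneC hMP hFH hS1 hKEX0 W hcm hr hT
  · exact hTors W hcm hr hT

/-- ★ **R′ `RankOneNonMinimalResidualAtTwo` (27107) BY NAME ⟸ WALL row 1 + Friedberg–Hoffstein + KEX⁰ + PRINT + its TORSION cell only** — the Ш cell of
the residual is discharged by the Selmer-free Kolyvagin statement KEX⁰ (same engine as U₂).  CONDITIONAL; proves nothing about BSD; closes nothing.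
[cite: FriedbergHoffstein1995, main theorem] [cite: GrossZagier1986, V.§2 (2.2)] [cite: Milne1972ArithmeticAV, §1 Thm. 1] -/
theorem rankOneNonMinimalResidualAtTwo_of_kex0_of_torsionCell_of_facts
    (hGZ : ∀ (N : ℕ) [NeZero N] (W : WeierstrassCurve ℚ) (K : Type) [Field K] [NumberField K], gross_zagier N W K)
    (hGZK : rank_eq_analyticRank_of_analyticRank_le_one) (hmod : hasEntireLFunction_rat)
    (hMilneC : Milne1972.bsdQuotient_baseChange_quadratic_anyModel) (hMP : nonempty_modularParametrizationData)
    (hFH : friedbergHoffstein_exists_heegnerField_split_twist_ne_zero)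
    (hS1 : ∀ (W : WeierstrassCurve ℚ) [W.IsElliptic] [W.IsGloballyMinimal], ¬ W.HasCM → W.analyticRank = 0 → BSDp W 2)
    (hKEX0 : ∀ (W : WeierstrassCurve ℚ) [W.IsElliptic] [W.IsGloballyMinimal] [NeZero (W.conductorNorm ℤ)],
      ¬ W.HasCM → W.analyticRank = 1 → (∀ P : W.toAffine.Point, 2 • P = 0 → P = 0) →
      ∀ (K : Type) [Field K] [NumberField K], IsImaginaryQuadratic K →
        Odd (NumberField.discr K) → NumberField.discr K ≠ -3 → SatisfiesHeegnerHypothesis (W.conductorNorm ℤ) K →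
        ((Ideal.span {(2 : ℤ)}).primesOver (𝓞 K)).ncard = 2 →
        ∀ (Wd : WeierstrassCurve ℚ) [Wd.IsElliptic] [Wd.IsGloballyMinimal],
          (∃ C : VariableChange ℚ, C • W.quadraticTwist (NumberField.discr K : ℚ) = Wd) →
        (W.quadraticTwist (NumberField.discr K : ℚ)).entireLFunction 1 ≠ 0 →
        ∀ (Dt : ModularParametrizationData W (W.conductorNorm ℤ)) (β : ℤ) (ι : K →+* ℂ) (d₁ : KolyvaginHeegnerData Dt β ι 1),
          ∃ M₀ : ℕ,
            (∃ Q : (W.baseChange (ringClassField K ι 1)).toAffine.Point, ((2 ^ M₀ : ℕ) : ℤ) • Q = d₁.derivedPoint) ∧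
            (¬ ∃ Q : (W.baseChange (ringClassField K ι 1)).toAffine.Point, ((2 ^ (M₀ + 1) : ℕ) : ℤ) • Q = d₁.derivedPoint) ∧
            Nat.card (AddCommGroup.primaryComponent (W.baseChange K).sha 2) *
                2 ^ (2 * (padicValInt 2 Dt.c + padicValNat 2 W.tamagawaProduct)) = 2 ^ (2 * M₀))
    (hTors : ∀ (W : WeierstrassCurve ℚ) [W.IsElliptic] [W.IsGloballyMinimal],
      ¬ W.HasCM → W.analyticRank = 1 → (¬ ∀ P : W.toAffine.Point, 2 • P = 0 → P = 0) → BSDp W 2) :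
    RankOneNonMinimalResidualAtTwo :=
  (rankOneBSDTwo_iff_minimalTwin_and_residual.mp
    (rankOneBSDTwo_of_kex0_of_torsionCell_of_facts hGZ hGZK hmod hMilneC hMP hFH hS1 hKEX0 hTors)).2

/-- **Conversely the TORSION cell is BSD-necessary** (it is a sub-statement of «rank-one BSD₂»), so the decomposition of the previous theorem is lossless
modulo WALL + PRINT together with `NoTwoTorsion.kex0_of_rankOneNoTwoTorsionBSDTwo_of_wall_of_facts`. [folklore] -/
theorem torsionCell_of_rankOneBSDTwo
    (h : ∀ (W : WeierstrassCurve ℚ) [W.IsElliptic] [W.IsGloballyMinimal], ¬ W.HasCM → W.analyticRank = 1 → BSDp W 2) :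
    ∀ (W : WeierstrassCurve ℚ) [W.IsElliptic] [W.IsGloballyMinimal],
      ¬ W.HasCM → W.analyticRank = 1 → (¬ ∀ P : W.toAffine.Point, 2 • P = 0 → P = 0) → BSDp W 2 :=
  fun W _ _ hcm hr _ ↦ h W hcm hr

/-- **And the no-`2`-torsion statement is BSD-necessary too** (the other sub-statement; it is the conclusion of `NoTwoTorsion` §4 and the hypothesis of
its §5). [folklore] -/
theorem rankOneNoTwoTorsionBSDTwo_of_rankOneBSDTwo
    (h : ∀ (W : WeierstrassCurve ℚ) [W.IsElliptic] [W.IsGloballyMinimal], ¬ W.HasCM → W.analyticRank = 1 → BSDp W 2) :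
    ∀ (W : WeierstrassCurve ℚ) [W.IsElliptic] [W.IsGloballyMinimal],
      ¬ W.HasCM → W.analyticRank = 1 → (∀ P : W.toAffine.Point, 2 • P = 0 → P = 0) → BSDp W 2 :=
  fun W _ _ hcm hr _ ↦ h W hcm hr

end Summit.BirchSwinnertonDyer.BirchSwinnertonDyer.Theorems.GenusExact.TwinSwap.AnalyticTwin.NoTwoTorsion.Census

end
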